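import Summits.BirchSwinnertonDyer.BirchSwinnertonDyer.Theorems.BiquadraticEisensteinDescentEisensteinHeartFlatCMInertBadKPrimeCMDatumAdapter
import Summits.BirchSwinnertonDyer.BirchSwinnertonDyer.Theorems.BiquadraticEisensteinDescentEisensteinHeartFlatCMInertBadKPrimeSqrtEndomorphismTwist
import Summits.BirchSwinnertonDyer.BirchSwinnertonDyer.Theorems.BiquadraticEisensteinDescentEisensteinHeartFlatCMInertBadKPrimeBiquadraticPrimes
import HarnessLib

set_option linter.dupNamespace false -- `Summit.BirchSwinnertonDyer.BirchSwinnertonDyer.Theorems.…` (summit = sub)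
set_option autoImplicit false

/-!
# Crux `EisensteinHeartFlatCMInertBadKPrime` (stmt-BirchSwinnertonDyer-21341), line `hsieh-lambda`, layer 2 — the eighth CM `j`-invariant:
# `j = -12288000` (`27a`, order of discriminant `-27`) via the tree's kernel-certified `27`-isogeny `cert27` (`[3√-3]`, `ψ² = -27`)

Route `BiquadraticEisensteinDescent` (cell `pub/bsd-wall`, width-prover seat `bsd-wall-cm-bed-w1` g5). Companion of `…CMLeaf` (seven `j` with `d_K`
an odd prime discriminant): for `j = -12288000` the endomorphism ring is the ORDER `ℤ[3ω]` of discriminant `-27`, which does not contain `√-3` but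
contains `3√-3 = √-27`; the tree's certificate `cert27` (`Literature/…/CMIsogenyCertificates.lean`) is the cyclic `27`-isogeny `E → E^{(-27)}` with
kernel `E[3√-3]`, so the whole V3 chain runs with `d₀ = -27` (`K(√-27) = K(√-3) = K·K_CM`; `-27` is a non-square mod `p` iff `-3` is, `p ≠ 3`;
`ℤ_p[X]/(X² + 27) = ℤ_p[√-3]` for `p ≠ 3`).

* `isCMTwistCert_cert27`, `model27` — numeric side conditions of `cert27` (`j = -12288000`, `Δ = -2¹²·3⁵`);
* `isSquare_neg27_iff` — `IsSquare (-27 : ZMod p) ↔ IsSquare (-3 : ZMod p)` for `p ≠ 3`;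
* `exists_sqrt27_endomorphism_of_j_eq` — `ψ = [3√-3]` in Galois-action form on `(W ⊗ K)(K̄)` for `W.j = -12288000`, `r² = -27`;
* **`heartShape_xac_of_cmInert_of_j_eq_neg12288000`** — the ♭-heart shape of `Ch_Λ(X_ac(W_K))` from `CMInert W p` (`p ≠ 2, 3`), `p` split in `K`,
  `U = Stab(√-27)`, `X_ac` f.g. torsion and the ∀-admissible V4 input with `d₀ = -27` (NOT asserted).

THEOREMS ONLY (no definition, no named fact, no instance, no `sorry`); nothing about V2/V4 or any case of BSD is asserted; BSD is not proved by any of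
this. Supports stmt-BirchSwinnertonDyer-21341 as a helper.

References: [SilvermanAdvancedTopics1994] II §2 Prop. II.2.3.1, App. A §3 (order of discriminant `-27`, `j = -2¹⁵·3·5³`); [SilvermanAEC2009] Cor. III.6.3;
[CoxPrimes2013] §7.B (orders in imaginary quadratic fields).
-/

noncomputable section

open scoped Classical

namespace Summit.BirchSwinnertonDyer.BirchSwinnertonDyer.Theorems.BiquadraticEisensteinDescentEisensteinHeartFlatCMInertBadKPrimeCMLeafTwentySeven

open NumberField IsDedekindDomain PowerSeries Field WeierstrassCurve
  Literature.NumberTheory.EllipticCurves Literature.NumberTheory.EllipticCurves.GreenbergSelmer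
  Literature.NumberTheory.EllipticCurves.Module
  Literature.NumberTheory.EllipticCurves.IwasawaDual Literature.NumberTheory.GaloisRepresentations
  Literature.NumberTheory.EllipticCurves.PolyCert
  Literature.NumberTheory.EllipticCurves.CMIsogenyCert
  Literature.NumberTheory.EllipticCurves.DeuringModels
  Literature.NumberTheory.EllipticCurves.Rank1Residual
  Summit.BirchSwinnertonDyer.Rank1Residual.X11b Summit.BirchSwinnertonDyer.Rank1Residual.X11b.AcSelmer
  Summit.BirchSwinnertonDyer.BirchSwinnertonDyer.Theorems.BiquadraticEisensteinDescentDefs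
  Summit.BirchSwinnertonDyer.BirchSwinnertonDyer.Theorems.BiquadraticEisensteinDescentEisensteinHeartFlatCMInertBadKPrimeSelmerTower
  Summit.BirchSwinnertonDyer.BirchSwinnertonDyer.Theorems.BiquadraticEisensteinDescentEisensteinHeartFlatCMInertBadKPrimeShapiroDatum
  Summit.BirchSwinnertonDyer.BirchSwinnertonDyer.Theorems.BiquadraticEisensteinDescentEisensteinHeartFlatCMInertBadKPrimeCMDatumAdapter
  Summit.BirchSwinnertonDyer.BirchSwinnertonDyer.Theorems.BiquadraticEisensteinDescentEisensteinHeartFlatCMInertBadKPrimeSqrtEndomorphismTwist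
  Summit.BirchSwinnertonDyer.BirchSwinnertonDyer.Theorems.BiquadraticEisensteinDescentEisensteinHeartFlatCMInertBadKPrimeBiquadraticPrimes

/-! ## §1 The certificate `cert27` (`j = -12288000`, `d₀ = -27`) -/

/-- `cert27` is a CM twist certificate for `d = -27` (twist `E' = E^{(-27)}`, `deg U = 27`, `T = 0`). [folklore] -/
theorem isCMTwistCert_cert27 : DeuringCert.IsCMTwistCert cert27 (-27) where
  a₁ := rfl
  a₂ := rfl
  a₃ := rfl
  a₁' := rfl
  a₂' := rfl
  a₃' := rfl
  a₄' := by decide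
  a₆' := by decide
  T := rfl
  U_top := by decide
  h_top := by decide
  deg := by decide

/-- `Δ` and `c₄³ = jΔ` for the model of `cert27` (`j = -12288000 = -2¹⁵·3·5³`, `Δ = -2¹²·3⁵`). [folklore] -/
theorem model27 : (DeuringCert.curve cert27).Δ = -(2 ^ 12 * 3 ^ 5) ∧
    (DeuringCert.curve cert27).c₄ ^ 3 = -12288000 * (DeuringCert.curve cert27).Δ := by
  constructor <;> decide

/-! ## §2 `-27` versus `-3` modulo `p` -/

/-- For `p ≠ 3`: `-27 = (-3)·3²` is a square mod `p` iff `-3` is. [folklore] -/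
theorem isSquare_neg27_iff {p : ℕ} [Fact p.Prime] (hp3 : p ≠ 3) :
    IsSquare (((-27 : ℤ) : ℤ) : ZMod p) ↔ IsSquare (((-3 : ℤ) : ℤ) : ZMod p) := by
  have h3 : (3 : ZMod p) ≠ 0 := by
    intro h
    have := (ZMod.natCast_eq_zero_iff 3 p).mp (by exact_mod_cast h)
    exact hp3 ((Nat.prime_dvd_prime_iff_eq (Fact.out : p.Prime) Nat.prime_three).mp this)
  have e : (((-27 : ℤ) : ℤ) : ZMod p) = (((-3 : ℤ) : ℤ) : ZMod p) * (3 * 3) := by push_cast; ring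
  rw [e]
  constructor
  · rintro ⟨y, hy⟩
    refine ⟨y * 3⁻¹, ?_⟩
    have : (((-3 : ℤ) : ℤ) : ZMod p) = y * y * (3⁻¹ * 3⁻¹) := by
      rw [← hy, mul_assoc, show (3 : ZMod p) * 3 * (3⁻¹ * 3⁻¹) = (3 * 3⁻¹) * (3 * 3⁻¹) by ring,
        mul_inv_cancel₀ h3, one_mul, mul_one]
    rw [this]; ring
  · rintro ⟨y, hy⟩
    exact ⟨y * 3, by rw [hy]; ring⟩

/-! ## §3 `[3√-3]` in Galois-action form for `j = -12288000` -/

section Endo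

variable (W : WeierstrassCurve ℚ) [W.IsElliptic] {K : Type} [Field K] [CharZero K]

/-- **`ψ = [3√-3]` on `(W ⊗ K)(K̄)` for `W.j = -12288000`**: for any field `K` of characteristic `0`, `r ∈ K̄` with `r² = -27`, `r ≠ 0`, and `σ₀ ∈ Γ_K` with
`σ₀ r = -r`: an additive `ψ` with `σ • ψ P = ψ (σ • P)` for `σ r = r`, `σ • ψ P = -ψ (σ • P)` for `σ r = -r`, and `ψ (ψ P) = (-27) • P`, from the tree's
certificate `cert27` and the sign-form twist transport. [cite: SilvermanAdvancedTopics1994, II §2 Prop. II.2.3.1 and App. A §3] -/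
theorem exists_sqrt27_endomorphism_of_j_eq (hj : W.j = -12288000)
    (r : AlgebraicClosure K) (hr : r ^ 2 = algebraMap K (AlgebraicClosure K) (((-27 : ℤ) : ℤ) : K)) (hr0 : r ≠ 0)
    (σ₀ : absoluteGaloisGroup K) (hσ₀ : σ₀ • r = -r) :
    ∃ ψ : (W.baseChange K).geomPoints →+ (W.baseChange K).geomPoints,
      (∀ σ : absoluteGaloisGroup K, σ • r = r → ∀ P, σ • ψ P = ψ (σ • P)) ∧
      (∀ σ : absoluteGaloisGroup K, σ • r = -r → ∀ P, σ • ψ P = -ψ (σ • P)) ∧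
      (∀ P, ψ (ψ P) = (-27 : ℤ) • P) := by
  have hjK : (W.baseChange K).j = algebraMap ℚ K W.j := by simp only [baseChange, map_j]
  haveI : (W.baseChange K).IsElliptic := inferInstanceAs (W.map (algebraMap ℚ K)).IsElliptic
  rw [hj] at hjK
  exact exists_endomorphism_of_cert (IsogenyCert.check_of_checkFast checkFast_cert27)
    isCMTwistCert_cert27 cert27Cop checkCoprime_cert27 (by rw [show cert27Cop.ℓ = 10007 from rfl]; norm_num)
    model27.2 (by rw [model27.1]; norm_num) (by norm_num) (by norm_num) r hr hr0 σ₀ hσ₀ (W.baseChange K)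
    (by rw [hjK]; norm_num)

end Endo

/-! ## §4 The ♭-heart shape for `j = -12288000` with the CM datum discharged (`d₀ = -27`) -/

section Leaf

variable (W : WeierstrassCurve ℚ) [W.IsElliptic] {p : ℕ} [Fact p.Prime] {K : Type} [Field K] [NumberField K]
  (κ : ZpExtension K p) (𝔭 : HeightOneSpectrum (𝓞 K)) (S : Set (HeightOneSpectrum (𝓞 K)))
  (U : Subgroup (absoluteGaloisGroup K)) [U.Normal]

/-- **♭-heart shape of `Ch_Λ(X_ac(W_K))` for `W.j = -12288000`, CM datum discharged with `d₀ = -27`.** Hypotheses: `p ≠ 2, 3`, `CMInert W p`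
(so `-3`, hence `-27`, is a non-square mod `p`), `K` quadratic with `𝔭₁ ≠ 𝔭₂` above `p` (so `√-27 ∉ K`), `U ≤ Γ_K` with `σ ∈ U ↔ σ(√-27) = √-27`
(`√-27 := geomSqrt (-27)`), ANY generator `γ`, `X_ac` f.g. torsion, and `hV4` for EVERY admissible `(ψ, φ, γ′, f, h, δ, b, ι)` with `d₀ = -27`
(NOT asserted). [cite: PollackRubin2004, proof of Thm. 7.3] [cite: SilvermanAdvancedTopics1994, II §2, Thm. II.2.2(b)] -/
theorem heartShape_xac_of_cmInert_of_j_eq_neg12288000 (hj : W.j = -12288000)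
    (hp2 : p ≠ 2) (hp3 : p ≠ 3) (hinert : CMInert W p) (hK2 : Module.finrank ℚ K = 2)
    {𝔭₁ 𝔭₂ : HeightOneSpectrum (𝓞 K)} (h𝔭₁ : ((p : ℕ) : 𝓞 K) ∈ 𝔭₁.asIdeal) (h𝔭₂ : ((p : ℕ) : 𝓞 K) ∈ 𝔭₂.asIdeal) (hne : 𝔭₁ ≠ 𝔭₂)
    (hUr : ∀ σ : absoluteGaloisGroup K, σ ∈ U ↔ σ • geomSqrt (((-27 : ℤ) : ℤ) : K) = geomSqrt (((-27 : ℤ) : ℤ) : K))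
    (γ : absoluteGaloisGroup K) [Fact (κ.IsTopGenerator γ)]
    [Module.Finite (IwasawaAlgebra p) (XAc (W.baseChange K) p κ 𝔭 S γ)]
    (hM : Module.IsTorsion (IwasawaAlgebra p) (XAc (W.baseChange K) p κ 𝔭 S γ))
    {Q : PowerSeries 𝓞_ℂ_[p]}
    (hV4 : ∀ (ψ : (W.baseChange K).geomPoints →+ (W.baseChange K).geomPoints)
      (_ : ∀ σ : absoluteGaloisGroup K, σ • geomSqrt (((-27 : ℤ) : ℤ) : K) = geomSqrt (((-27 : ℤ) : ℤ) : K) → ∀ P, σ • ψ P = ψ (σ • P))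
      (_ : ∀ σ : absoluteGaloisGroup K, σ • geomSqrt (((-27 : ℤ) : ℤ) : K) = -geomSqrt (((-27 : ℤ) : ℤ) : K) → ∀ P, σ • ψ P = -ψ (σ • P))
      (_ : ∀ P, ψ (ψ P) = (-27 : ℤ) • P)
      (φ : (W.baseChange K).geomPrimaryTorsion p →+ (W.baseChange K).geomPrimaryTorsion p)
      (_ : ∀ m, ((φ m : (W.baseChange K).geomPrimaryTorsion p) : (W.baseChange K).geomPoints) = ψ m)
      (hφH' : ∀ (x : (κ.kerSubgroup ⊓ U : Subgroup (absoluteGaloisGroup K))) (m : (W.baseChange K).geomPrimaryTorsion p), φ (x • m) = x • φ m)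
      (hφU : ∀ σ ∈ U, ∀ m : (W.baseChange K).geomPrimaryTorsion p, φ (σ • m) = σ • φ m)
      (hφU' : ∀ σ, σ ∉ U → ∀ m : (W.baseChange K).geomPrimaryTorsion p, φ (σ • m) = -(σ • φ m))
      (hφ2 : ∀ m, φ (φ m) = (-27 : ℤ) • m)
      (γ' : absoluteGaloisGroup K) (_ : κ.IsTopGenerator γ') (_ : γ' ∈ U)
      (f : AddMonoid.End (selmerOver (κ.kerSubgroup ⊓ U) ((W.baseChange K).geomPrimaryTorsion p) p 𝔭 S))
      (_hf : ∀ s, ((f s : selmerOver (κ.kerSubgroup ⊓ U) ((W.baseChange K).geomPrimaryTorsion p) p 𝔭 S) :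
        subgroupH1 (κ.kerSubgroup ⊓ U) ((W.baseChange K).geomPrimaryTorsion p)) =
          conjH1 (κ.kerSubgroup ⊓ U) ((W.baseChange K).geomPrimaryTorsion p) γ' s)
      (h : IsLocNil p (f - 1))
      (δ : LocNilDual (selmerOver (κ.kerSubgroup ⊓ U) ((W.baseChange K).geomPrimaryTorsion p) p 𝔭 S) f h →ₗ[IwasawaAlgebra p]
        LocNilDual (selmerOver (κ.kerSubgroup ⊓ U) ((W.baseChange K).geomPrimaryTorsion p) p 𝔭 S) f h)
      (hδ : ∀ (x : LocNilDual (selmerOver (κ.kerSubgroup ⊓ U) ((W.baseChange K).geomPrimaryTorsion p) p 𝔭 S) f h)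
        (s t : selmerOver (κ.kerSubgroup ⊓ U) ((W.baseChange K).geomPrimaryTorsion p) p 𝔭 S),
        (t : subgroupH1 (κ.kerSubgroup ⊓ U) ((W.baseChange K).geomPrimaryTorsion p)) =
          resH1Hom (ContinuousMonoidHom.id _) φ hφH' (s : subgroupH1 (κ.kerSubgroup ⊓ U) ((W.baseChange K).geomPrimaryTorsion p)) →
          δ x s = x t)
      (b : Module.Basis (Fin 2) ℤ_[p] (AdjoinRoot (Polynomial.X ^ 2 - Polynomial.C (((-27 : ℤ) : ℤ) : ℤ_[p]) : Polynomial ℤ_[p])))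
      (hb0 : b 0 = 1)
      (hb1 : b 1 * b 1 = algebraMap ℤ_[p] (AdjoinRoot (Polynomial.X ^ 2 - Polynomial.C (((-27 : ℤ) : ℤ) : ℤ_[p]) : Polynomial ℤ_[p]))
        (((-27 : ℤ) : ℤ) : ℤ_[p]))
      (ι : AdjoinRoot (Polynomial.X ^ 2 - Polynomial.C (((-27 : ℤ) : ℤ) : ℤ_[p]) : Polynomial ℤ_[p]) →+* 𝓞_ℂ_[p])
      (_ : ι.comp (algebraMap ℤ_[p] _) = R1.toCpInt p),
      ∃ m : ℕ, ∀ x ∈ (charIdeal (PowerSeries (AdjoinRoot (Polynomial.X ^ 2 - Polynomial.C (((-27 : ℤ) : ℤ) : ℤ_[p]) : Polynomial ℤ_[p])))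
          (WithQuadratic (LocNilDual (selmerOver (κ.kerSubgroup ⊓ U) ((W.baseChange K).geomPrimaryTorsion p) p 𝔭 S) f h) b hb0 hb1 δ
            (delta_sq (W.baseChange K) κ 𝔭 S U φ hφH' hφU hφU' (-27 : ℤ) hφ2 f h δ hδ))).map (PowerSeries.map ι),
        (PowerSeries.C ((p : ℕ) : 𝓞_ℂ_[p]) : PowerSeries 𝓞_ℂ_[p]) ^ m * x ∈ Ideal.span {Q}) :
    ∃ m : ℕ, ∀ x ∈ (XAc.charIdeal (W.baseChange K) p κ 𝔭 S γ).map (PowerSeries.map (R1.toCpInt p)),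
      (PowerSeries.C ((p : ℕ) : 𝓞_ℂ_[p]) : PowerSeries 𝓞_ℂ_[p]) ^ m * x ∈ Ideal.span {Q} := by
  set r : AlgebraicClosure K := geomSqrt (((-27 : ℤ) : ℤ) : K) with hrdef
  -- `-27` is a non-square mod `p`
  have hd3 : ¬ IsSquare ((cmFieldDiscrOfJ W.j : ℤ) : ZMod p) := not_isSquare_of_cmInert hp2 hinert
  have hd3' : ¬ IsSquare (((-3 : ℤ) : ℤ) : ZMod p) := by
    rw [hj] at hd3; norm_num [cmFieldDiscrOfJ] at hd3 ⊢; exact hd3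
  have hd' : ¬ IsSquare (((-27 : ℤ) : ℤ) : ZMod p) := fun hsq ↦ hd3' ((isSquare_neg27_iff hp3).mp hsq)
  have hd : ∀ y : ZMod p, y * y ≠ PadicInt.toZMod (((-27 : ℤ) : ℤ) : ℤ_[p]) := by
    intro y hy
    rw [map_intCast] at hy
    exact hd' ⟨y, hy.symm⟩
  -- `r = √-27 ∈ K̄ ∖ K`
  have hr2 : r ^ 2 = algebraMap K (AlgebraicClosure K) (((-27 : ℤ) : ℤ) : K) := geomSqrt_sq _
  have hr : r * r = algebraMap K (AlgebraicClosure K) (((-27 : ℤ) : ℤ) : K) := by rw [← sq]; exact hr2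
  have hKsq : ¬ ∃ y : K, y ^ 2 = (((-27 : ℤ) : ℤ) : K) := not_exists_sq_eq_of_split hK2 hd' h𝔭₁ h𝔭₂ hne
  have hrK : r ∉ Set.range (algebraMap K (AlgebraicClosure K)) :=
    sqrt_not_mem_range hKsq (x := r) (by rw [hr2, map_intCast])
  have hr0 : r ≠ 0 := ne_zero_of_not_mem_range hrK
  obtain ⟨σ₀, hσ₀⟩ := exists_smul_eq_neg r (((-27 : ℤ) : ℤ) : K) hr hrK
  -- the CM endomorphism `[3√-3]` in Galois-action form
  obtain ⟨ψ, hψU, hψU', hψ2⟩ := exists_sqrt27_endomorphism_of_j_eq W hj r hr2 hr0 σ₀ hσ₀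
  exact heartShape_xac_of_sqrt_endomorphism (W.baseChange K) κ 𝔭 S U hp2 γ ψ (-27 : ℤ) r hr hrK hUr hψU hψU' hψ2 hd hM
    (hV4 ψ hψU hψU' hψ2)

end Leaf

end Summit.BirchSwinnertonDyer.BirchSwinnertonDyer.Theorems.BiquadraticEisensteinDescentEisensteinHeartFlatCMInertBadKPrimeCMLeafTwentySeven

end
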